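import Summits.QuantumFields.GaugeBoot.CovariantLinkRPNegativeCoupling
import Summits.QuantumFields.GaugeBoot.EvenTorusLimitLinkRP
import HarnessLib

/-!
# Plain link RP does not imply covariant link RP: natural witnesses at negative coupling
(gauge-boot, Class-B brick; the link family at `β < 0`, part 2/2)

HONEST FRAMING (cell `pub-gaugeboot`, page 1 of every file): the venture produces certified bounds
on lattice expectations at stated coupling, gauge group, dimension and torus size; NOT a mass gap,
NOT a continuum limit, NOT a string tension; NOT Yang–Mills-summit-bearing (barriers
`FixedCouplingUltralocality`, `PerturbativeInvisibility`). Structural bookkeeping (which SDP blocks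
are exact for which infinite-volume states); certifies no number.

## Content

`ZdCovariantLinkRP.lean` proved `IsCovariantLinkRP i μ → IsReflectionPositiveFor (Θ_i) (half) μ`
for `Θ_i`-invariant probability measures ("covariant ⇒ plain"; "the converse is not claimed").
THE CONVERSE IS FALSE, on natural states of lattice Yang–Mills theory: by
`EvenTorusLimitLinkRP.lean` the limit points along even torus sizes are PLAINLY link-RP in every
axis at every real `β` (central involution with `ρ z = -1`, or `d = 2`), and by
`CovariantLinkRPNegativeCoupling.lean` NO one-link Haar-shift state at `β < 0` — in particular no
torus limit point — is COVARIANTLY link-RP in any axis (DLR sign rule vs. the `1 × 1` cut-loop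
block).

* ★★★ **`exists_linkRP_and_not_isCovariantLinkRP_of_central`** — `G : Type` compact Hausdorff
  second countable, `z` central with `z² = 1`, `ρ` continuous with `ρ z = -1` (`N ≥ 1`), `d ≥ 2`,
  `β < 0`: some `μ ∈ infiniteVolumeLimitPoints ρ β` (a translation-invariant one-link Haar-shift
  probability measure, invariant under all link reflections) is
  `IsReflectionPositiveFor (configLinkReflect i) (linkHalfEdges i)` for EVERY axis `i` and
  `IsCovariantLinkRP i μ` for NO axis `i`;
* ★★★ **`exists_linkRP_and_not_isCovariantLinkRP_twoDim`** — the same on `ℤ²` for EVERY compact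
  `G` and continuous `ρ` without invariant vectors (e.g. `SU(3)` in two dimensions);
* ★★★ **`exists_linkRP_and_not_isCovariantLinkRP_suEven`** / **`…_su2`** — `SU(2n)`, `SU(2)`,
  every `d ≥ 2`;
* ★★★ **`not_linkRP_imp_isCovariantLinkRP_su2`** — on `LGConfig d SU(2)`, `d ≥ 2`, it is NOT the
  case that every `Θ_0`-invariant probability measure which is reflection positive for
  `(Θ_0, linkHalfEdges 0)` is covariantly link-RP in `x_0 = ½`.

Reading for the certificate binder (R8 framing): at `β < 0` the PLAIN link blocks
(`ClassBState.linkRP`, observables on both sides not touching the crossing links) remain exact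
constraints for these states, while the Kazakov–Zheng CUT-LOOP `R_link` blocks (half-words glued
through the crossing links; `ClassBLinkCutWordBlocks.lean`) do not — already their `1 × 1` member,
the plaquette, has the wrong sign. At `β ≥ 0` both hold (`ClassBLimitLinkRP`,
`ClassBLimitCovariantLinkRP`). Structural only.

Elementary; not in print in this form as far as the cell's searches go (OS link RP: Osterwalder–
Seiler 1978 §2; Seiler LNP 159 Thm. 2.2; cut loops: Kazakov–Zheng arXiv:2203.11360 §3.1).
-/

noncomputable section

open MeasureTheory Filter Topology Complex
open scoped ComplexOrder ComplexConjugate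
open Literature.Probability.LatticeModels (Site)
open Literature.MathematicalPhysics.QuantumLattice
open Literature.MathematicalPhysics.QuantumFieldTheory (haarProbability)

namespace Summit.QuantumFields.GaugeBoot

variable {d N : ℕ}

/-! ## The separation: plainly link-RP in every axis, covariantly link-RP in none -/

section Separation

variable {G : Type} [Group G] [TopologicalSpace G] [IsTopologicalGroup G] [CompactSpace G]
  [MeasurableSpace G] [BorelSpace G] [SecondCountableTopology G] [T2Space G]
variable (ρ : G →* Matrix (Fin N) (Fin N) ℂ)

omit [TopologicalSpace G] [IsTopologicalGroup G] [CompactSpace G] [MeasurableSpace G] [BorelSpace G]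
  [SecondCountableTopology G] [T2Space G] in
/-- `ρ z = -1` is the central-scalar condition `ρ z = ω • 1` with `ω = -1 ≠ 1`. -/
theorem eq_neg_one_smul_one_of_eq_neg_one {z : G} (hρz : ρ z = -1) :
    ρ z = (-1 : ℂ) • (1 : Matrix (Fin N) (Fin N) ℂ) := by
  rw [hρz, neg_one_smul]

/-- ★★★ **Plain link RP does not imply covariant link RP — a natural witness.** `G : Type`
compact Hausdorff second countable with a central involution `z` (`z² = 1`), `ρ` continuous with
`ρ z = -1` (`N ≥ 1`; `SU(2)`, `SU(2n)`, `U(N)` fundamental), `d ≥ 2`, `β < 0`. There is an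
infinite-volume limit point `μ ∈ infiniteVolumeLimitPoints ρ β` of the torus Wilson states (a
translation-invariant one-link Haar-shift probability measure, invariant under the link
reflections) which is reflection positive in EVERY link hyperplane `x_i = ½` for all bounded
measurable half-space observables (`ClassB.lean`'s `linkRP`), and covariantly link-RP
(`IsCovariantLinkRP`, the cut-loop form) in NO axis. -/
theorem exists_linkRP_and_not_isCovariantLinkRP_of_central [NeZero N] (hρ : Continuous ρ) {z : G}
    (hzc : ∀ g, z * g = g * z) (hz2 : z * z = 1) (hρz : ρ z = -1) (hd : 2 ≤ d) {β : ℝ}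
    (hβ : β < 0) :
    ∃ μ ∈ infiniteVolumeLimitPoints (d := d) ρ β,
      (∀ i : Fin d, IsReflectionPositiveFor (configLinkReflect (G := G) i) (linkHalfEdges i) μ) ∧
      ∀ i : Fin d, ¬ IsCovariantLinkRP i μ := by
  haveI : NeZero d := ⟨by omega⟩
  obtain ⟨μ, φ, hφ, hμ⟩ := exists_isInfiniteVolumeLimitAlong_even (d := d) ρ hρ β
  have hmem := mem_infiniteVolumeLimitPoints_of_along_even ρ hφ hμ
  exact ⟨μ, hmem, linkRP_of_isInfiniteVolumeLimitAlong_even_of_central ρ hρ hzc hz2 hρz hφ hμ,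
    fun i => not_isCovariantLinkRP_of_mem_infiniteVolumeLimitPoints_of_neg ρ hρ
      (integral_re_trace_mul_eq_zero_of_smul_one ρ hρ (eq_neg_one_smul_one_of_eq_neg_one ρ hρz)
        (by norm_num)) hd hβ hmem i⟩

/-- ★★★ **Two dimensions, every compact gauge group.** `G : Type` compact Hausdorff second
countable, `ρ` continuous (`N ≥ 1`) without invariant vectors, `β < 0`: there is a limit point
`μ ∈ infiniteVolumeLimitPoints ρ β` on `ℤ²` which is plainly link-RP in both axes and covariantly
link-RP in neither (e.g. `SU(3)` in two dimensions). -/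
theorem exists_linkRP_and_not_isCovariantLinkRP_twoDim [NeZero N] (hρ : Continuous ρ)
    (hρ0 : ∀ m : G, ∫ g, ((ρ (g * m)).trace).re ∂(haarProbability G) = 0) {β : ℝ} (hβ : β < 0) :
    ∃ μ ∈ infiniteVolumeLimitPoints (d := 2) ρ β,
      (∀ i : Fin 2, IsReflectionPositiveFor (configLinkReflect (G := G) i) (linkHalfEdges i) μ) ∧
      ∀ i : Fin 2, ¬ IsCovariantLinkRP i μ := by
  obtain ⟨μ, φ, hφ, hμ⟩ := exists_isInfiniteVolumeLimitAlong_even (d := 2) ρ hρ β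
  have hmem := mem_infiniteVolumeLimitPoints_of_along_even ρ hφ hμ
  exact ⟨μ, hmem, linkRP_of_isInfiniteVolumeLimitAlong_even_twoDim ρ hρ hφ hμ,
    fun i => not_isCovariantLinkRP_of_mem_infiniteVolumeLimitPoints_of_neg ρ hρ hρ0 le_rfl hβ hmem i⟩

/-- ★★★ **`SU(2n)` (`2n ≥ 2`), every `d ≥ 2`, `β < 0`**: a torus limit point of lattice
`SU(2n)` Yang–Mills (fundamental Wilson action) plainly link-RP in every axis and covariantly
link-RP in none (`z = -1 ∈ SU(2n)`). -/
theorem exists_linkRP_and_not_isCovariantLinkRP_suEven {M : ℕ} (hM : Even M) (h2 : 2 ≤ M)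
    (hd : 2 ≤ d) {β : ℝ} (hβ : β < 0) :
    ∃ μ ∈ infiniteVolumeLimitPoints (d := d) (fundamentalRep (Fin M)) β,
      (∀ i : Fin d, IsReflectionPositiveFor
        (configLinkReflect (G := Matrix.specialUnitaryGroup (Fin M) ℂ) i) (linkHalfEdges i) μ) ∧
      ∀ i : Fin d, ¬ IsCovariantLinkRP i μ := by
  haveI : NeZero M := ⟨by omega⟩
  haveI : SecondCountableTopology (Matrix (Fin M) (Fin M) ℂ) :=
    inferInstanceAs (SecondCountableTopology (Fin M → Fin M → ℂ))
  haveI : SecondCountableTopology (Matrix.specialUnitaryGroup (Fin M) ℂ) :=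
    Topology.IsEmbedding.subtypeVal.secondCountableTopology
  set z : Matrix.specialUnitaryGroup (Fin M) ℂ :=
    ⟨-1, TiltedRP.neg_one_mem_specialUnitaryGroup_of_even hM⟩ with hz
  refine exists_linkRP_and_not_isCovariantLinkRP_of_central (fundamentalRep (Fin M))
    (continuous_fundamentalRep (Fin M)) (z := z) (fun g => ?_) ?_ ?_ hd hβ
  · exact Subtype.ext (by simp [hz])
  · exact Subtype.ext (by simp [hz])
  · rw [fundamentalRep_apply]

/-- ★★★ **`SU(2)`, every `d ≥ 2`, `β < 0`** (the cell's gauge group of rows T1/T2): a torus limit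
point plainly link-RP in every axis and covariantly link-RP in none. -/
theorem exists_linkRP_and_not_isCovariantLinkRP_su2 (hd : 2 ≤ d) {β : ℝ} (hβ : β < 0) :
    ∃ μ ∈ infiniteVolumeLimitPoints (d := d) (fundamentalRep (Fin 2)) β,
      (∀ i : Fin d, IsReflectionPositiveFor
        (configLinkReflect (G := Matrix.specialUnitaryGroup (Fin 2) ℂ) i) (linkHalfEdges i) μ) ∧
      ∀ i : Fin d, ¬ IsCovariantLinkRP i μ :=
  exists_linkRP_and_not_isCovariantLinkRP_suEven even_two le_rfl hd hβ

/-- ★★★ **The converse of `IsCovariantLinkRP.linkRP` is false.** On `LGConfig d SU(2)`, `d ≥ 2`,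
it is NOT the case that every probability measure which is invariant under the link reflection
`Θ_0` and reflection positive for `(Θ_0, linkHalfEdges 0)` (all bounded measurable half-space
observables) is covariantly link-RP in the mirror `x_0 = ½`. -/
theorem not_linkRP_imp_isCovariantLinkRP_su2 (hd : 2 ≤ d) :
    ¬ ∀ (μ : Measure (LGConfig d (Matrix.specialUnitaryGroup (Fin 2) ℂ))),
      IsProbabilityMeasure μ →
      MeasurePreserving (configLinkReflect (G := Matrix.specialUnitaryGroup (Fin 2) ℂ) ⟨0, by omega⟩)
        μ μ →
      IsReflectionPositiveFor (configLinkReflect (G := Matrix.specialUnitaryGroup (Fin 2) ℂ)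
        ⟨0, by omega⟩) (linkHalfEdges ⟨0, by omega⟩) μ →
      IsCovariantLinkRP ⟨0, by omega⟩ μ := by
  haveI : NeZero d := ⟨by omega⟩
  haveI : SecondCountableTopology (Matrix (Fin 2) (Fin 2) ℂ) :=
    inferInstanceAs (SecondCountableTopology (Fin 2 → Fin 2 → ℂ))
  haveI : SecondCountableTopology (Matrix.specialUnitaryGroup (Fin 2) ℂ) :=
    Topology.IsEmbedding.subtypeVal.secondCountableTopology
  intro h
  obtain ⟨μ, hmem, hRP, hcov⟩ :=
    exists_linkRP_and_not_isCovariantLinkRP_su2 hd (β := -1) (by norm_num)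
  obtain ⟨L, _, hprob, _⟩ := id hmem
  have h0 : (⟨0, by omega⟩ : Fin d) = 0 := rfl
  rw [h0] at h
  exact hcov 0 (h μ hprob (measurePreserving_configLinkReflect_zero (fundamentalRep (Fin 2))
    (continuous_fundamentalRep (Fin 2)) hmem) (hRP 0))

end Separation

end Summit.QuantumFields.GaugeBoot
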